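import Summits.AtomisticToContinuum.BoseEinsteinCondensation.Theses.BECCutLineWeakDisorder
import Summits.AtomisticToContinuum.BoseEinsteinCondensation.Theses.BECClassicalWindow
import Summits.AtomisticToContinuum.BoseEinsteinCondensation.Theses.BECHeatBathGap
import Summits.AtomisticToContinuum.BoseEinsteinCondensation.Theorems.BECCutLineWeakDisorderGroundStateRigidityHardCoreOfConnected
import Summits.AtomisticToContinuum.BoseEinsteinCondensation.Theorems.BECCutLineWeakDisorderGroundStateRigidityStubPosOfConnected
import Summits.AtomisticToContinuum.BoseEinsteinCondensation.Theorems.BECCutLineWeakDisorderGroundStateRigidityLocBdd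
import HarnessLib.Audit

/-!
# Line `loose-pricing` — ALTERNATIVE skeleton for crux `GroundStateRigidity`
(item stmt-AtomisticToContinuum-9072, shared by 8 routes; strategist seat
planner-cstrat-stmt-AtomisticToContinuum-9072-s1-0, 2026-08-17; registered `--alt`, it does NOT touch the
live line `Sketch` of lead c4, whose landed stubs it re-uses by name)

Crux (fixed, by name): `GroundStateRigidity` — for every repulsive finite-range `v` there is `ρ₀ > 0`
such that for `0 < ρ < ρ₀`, all large `N` and every `η > 0` some `δ > 0` makes any two
`δ`-near-minimisers of the Dirichlet energy in the box of side `(N/ρ)^{1/3}` `η`-close in `L²` up to a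
constant phase.

## Why a second line: dodge the STUCK goal of `Sketch`

Line `Sketch` (skeleton v8) reduces the hard-core class, kernel-checked, to Stub 21 `stub_cubeConnected`
(dilute hard-sphere configuration space in the cube is PATH-CONNECTED, with labels) — Baryshnikov–Bubenik–
Kahle's open question (IMRN 2014 §6) and, by the lead's own structure theory (`NOTES-c4-KERNEL.md` §2),
"NOT safely true: vault foams are a credible counterexample mechanism". Connectivity is MORE than the
crux needs: uniqueness of the Bose ground state only needs the energy-minimising components of the free
region to form ONE `S_N`-orbit. This line prices the other components out of the ground state instead of
forbidding them:

* a component whose closure keeps one FIXED pair `(i, j)` at distance `< K b` ("tight bond") carries, for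
  every `C¹` function supported in it, the energy floor `E₀(N-1, L) + 1/(2K²b²)` per unit mass
  (`stub_confinementFloor`: a one-dimensional Poincaré inequality in ONE coordinate of particle `i`
  relative to particle `j`, and the ABSOLUTE floor `stub_absoluteFloor` — the Bose ground-state energy
  lies below the quadratic form of every `C¹` Dirichlet function, symmetric or not, by the density
  symmetrisation of `Literature/…/BosonicFloor.lean` — for the other `N - 1` particles);
* the principal sector is cheap to feed: `E₀(N, L) ≤ E₀(N-1, L) + C_I/s²` for every cell scale `s` with
  `128 N s³ ≤ L³`, `s ≥ 4 R₀` (`stub_cellInsertion`: pigeonhole-free-cell insertion of one unsymmetrised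
  particle, cross term killed by `∫|F|² dy ≡ 1`, no Jastrow factor, no averaging; `ABS` absorbs the
  missing symmetry) — at density `ρ` one may take `s ~ ρ^{-1/3}`, so `C_I/s² ≪ 1/(2K²b²)`;
* hence (`stub_vanishOffLoose`, the analytic glue: core cutoffs of the landed Stubs 15a/15b/15d, component
  splitting of `C¹` functions vanishing on the contact set, `ABS` on the loose part, `FLOOR` on each
  bonded part) every closed-form ground state VANISHES a.e. off the union `P₀` of the un-bonded
  components, as soon as all components off `P₀` are tight-bonded;
* the GEOMETRIC KERNEL shrinks from "the free region is connected" to `stub_uniqueLooseComponent`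
  (ULC): at `N b³ ≤ c₀ L³` all path components of the free region EXCEPT AT MOST ONE carry a tight bond
  `sup_C |xᵢ − xⱼ| < K b` for some fixed pair. `CubeConnected ⇒ ULC` trivially (one component); ULC
  survives every container-jammed obstruction (strut frameworks keep their contacts), i.e. exactly the
  vault foams that threaten Stub 21; it fails only for a LOOSE non-principal component ("treadmill": all
  pairs eventually separate beyond `K b` yet the component never meets the dilute one), for which no
  mechanism is known (KERNEL-c4 §3).
* Component-wise Perron–Frobenius on the carrier `P₀` is the LANDED machinery of `Sketch` (Stubs 14,
  16–20: `stub_vanishOffFree`, `stub_localTubeCore`, `stub_polygonalChain`, `stub_chainedTube`,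
  `stub_posOfConnected`, `stub_uniqueOfPosOn`) with `S = P₀` in place of the whole free region; class (a)
  (`v` essentially locally bounded on `(0,∞)`) is the landed `hasUniqueGroundState_of_essLocBdd`; the zoo
  of other walls is the shared open Stub 22, verbatim.

## Stubs (6; `sorry` only inside `stub_*`)

* `stub_absoluteFloor` (ABS, M): `E₀(N,L) · ‖f‖² ≤ 𝓔_v[f]` for every `C¹` `f` vanishing off the box
  (port of `BosonicFloor.lean` from the torus to the Dirichlet box).
* `stub_confinementFloor` (FLOOR, M–L): on `N+1` particles, if fibrewise the first coordinate of particle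
  `0` is confined to an interval of length `2R`, then `(E₀(N,L) + 1/(2R²)) ‖f‖² ≤ 𝓔_v[f]`
  (one-endpoint 1-D Poincaré in the coordinate `(0,0)` + ABS in the other `N` particles, Fubini along
  `vecCons`; cross interactions `≥ 0` dropped).
* `stub_cellInsertion` (INS, L): `∃ C_I > 0`, `E₀(N+1,L) ≤ E₀(N,L) + C_I/s²` whenever `v` has range `R₀`,
  `4R₀ ≤ s`, `128 (N+1) s³ ≤ L³`.
* `stub_uniqueLooseComponent` (ULC, the KERNEL; discrete geometry): see above.
* `stub_vanishOffLoose` (GLUE, L): ABS → FLOOR → for the pointwise hard-core class (`v = ⊤` on `[0,b]`),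
  `E₀(N) ≤ E₀(N-1) + μ` with `μ < 1/(2K²b²)`, and an open saturated `P₀ ⊆ F_b` off which every component
  is `K b`-bonded: every ground state vanishes a.e. off `P₀`.
* `stub_uniquenessKernelZoo` (ZOO, open; verbatim Stub 22 of `Sketch`, shared).

## Composition (sorry-free): `GroundStateRigidity_of`

`uniqueHardCoreLoose`: pointwise representative `v'` of the essential hard-core class (null sets of radii
are invisible), range `R₁ = max R₀ b`, cell scale `s₀ = max (4R₁) (2Kb√C_I)` (so `C_I/s₀² < 1/(2K²b²)`),
`ρ₀ = min ρ₁ (min (c₀/b³) (1/(128 s₀³)))`; eventually `E₀ < ⊤` (Stub 5a), `N b³ ≤ c₀ L³`, INS at `N-1`,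
ULC gives `P₀`, GLUE gives vanishing off `P₀`, `stub_posOfConnected` (fed with `stub_chainedTube
stub_localTubeCore`, the energy truncation `groundStateEnergy_trunc_iSup_hardCore` and polygonal chains in
`P₀`) gives positivity on `P₀`, `stub_uniqueOfPosOn` gives uniqueness, `hasUniqueGroundState_iff_offNull`
transfers back to `v`. `eventualUniqueness`: class (a) landed, hard-core class as above, zoo by Stub 22;
`GroundStateRigidity_of` by `stub_rigidityOfUnique stub_compactness`.
-/

noncomputable section

open MeasureTheory Filter Metric
open scoped ENNReal NNReal Topology

namespace Summit.AtomisticToContinuum.BoseEinsteinCondensation.Cruxes.GroundStateRigidity.LoosePricing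

open Literature.MathematicalPhysics.QuantumManyBody.BoseGas
open Summit.AtomisticToContinuum.BoseEinsteinCondensation.Theses.BECCutLineWeakDisorder
open Summit.AtomisticToContinuum.BoseEinsteinCondensation.Theorems.GroundStateRigidity

/-! ## Stubs -/

/-- **Stub A — the absolute floor (Bose = Boltzmann for the infimum).** For measurable `v ≥ 0` (hard cores
allowed) and EVERY `C¹` function `f` vanishing off the open box `Λ_L^N` — symmetric or not, normalised or
not — `E₀(N, L) · ∫|f|² ≤ ∫ (|∇f|² + V |f|²)`: the bosonic Dirichlet ground-state energy is the absolute
one. Port of `Literature/…/BosonicFloor.lean` (torus) to the box: symmetrise the DENSITY,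
`g_ε = √(ε² + ∑_σ |f ∘ σ|²) − ε` is `C¹`, Dirichlet and symmetric with `𝓔[g_ε] ≤ N! 𝓔[f]`
(`kineticDensity_sqrtSym_le`, convexity of `|∇·|²`), normalise, let `ε → 0` (`‖g_ε‖² → N! ‖f‖²`).
Degenerate cases: `‖f‖ = 0` or `𝓔 = ⊤` trivial; `E₀ = ⊤` forces `𝓔[f] = ⊤` for `f ≠ 0` by the same
symmetrisation. [cite: LSSY2005, Ch. 2 remark after (2.1); LiebLoss2001, Thm 7.8] -/
theorem stub_absoluteFloor :
    ∀ (N : ℕ) (v : ℝ → ℝ≥0∞) (L : ℝ) (f : Config N → ℂ), Measurable v → ContDiff ℝ 1 f →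
      (∀ X, X ∉ boxN N L → f X = 0) →
      groundStateEnergy v N L * ∫⁻ X, (‖f X‖₊ : ℝ≥0∞) ^ 2 ≤
        ∫⁻ X, (kineticDensity f X + interaction v X * (‖f X‖₊ : ℝ≥0∞) ^ 2) := by
  sorry

/-- **Stub B — the confinement floor (one tight coordinate costs `1/(2R²)` on top of the `N`-body floor).**
On `N + 1` particles written `vecCons x Y` (`x` = particle `0`, `Y` = the other `N`): if `f` is `C¹`,
vanishes off `Λ_L^{N+1}`, and for every `Y` the first coordinate `x 0` of particle `0` is confined to an
interval `|x 0 − a(Y)| < R` on the support, then `(E₀(N, L) + 1/(2R²)) ∫|f|² ≤ ∫ (|∇f|² + V|f|²)`.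
Proof: `|∇f|² ≥ |∂_{(0,0)} f|² + ∑_{k ≥ 1} |∇_k f|²` and `V_{N+1}(vecCons x Y) ≥ V_N(Y)` (pairs through
`0` dropped, `v ≥ 0`); on each line in the coordinate `(0,0)` the one-endpoint Poincaré bound
`∫|g|² ≤ 2R² ∫|g'|²` for `C¹` `g` supported in an interval of length `2R`; in the fibre `Y` at fixed `x`
the absolute floor (Stub A) for the `C¹` Dirichlet function `Y ↦ f (vecCons x Y)`; Tonelli along the
measure-preserving `vecCons` (`measurePreserving_vecCons`). [cite: LiebLoss2001, Thm 7.8] -/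
theorem stub_confinementFloor :
    ∀ (N : ℕ) (v : ℝ → ℝ≥0∞) (L R : ℝ) (f : Config (N + 1) → ℂ), Measurable v → 0 < R →
      ContDiff ℝ 1 f → (∀ X, X ∉ boxN (N + 1) L → f X = 0) →
      (∀ Y : Config N, ∃ a : ℝ, ∀ x : Space, R ≤ |x 0 - a| → f (Matrix.vecCons x Y) = 0) →
      (groundStateEnergy v N L + ENNReal.ofReal (1 / (2 * R ^ 2))) *
          ∫⁻ X, (‖f X‖₊ : ℝ≥0∞) ^ 2 ≤
        ∫⁻ X, (kineticDensity f X + interaction v X * (‖f X‖₊ : ℝ≥0∞) ^ 2) := by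
  sorry

/-- **Stub C — the cell insertion bound (the principal sector is cheap to feed).** There is an absolute
`C_I > 0` such that for measurable `v` of range `R₀` (`v = 0` beyond `R₀`; anything, e.g. `⊤`, below),
every cell scale `s` with `4 R₀ ≤ s` and `128 (N+1) s³ ≤ L³`: `E₀(N+1, L) ≤ E₀(N, L) + C_I / s²`.
Proof (Boltzmann insertion + Stub A): tile `Λ_L` by `m³` cubes of side `L/m ∈ [s, 2s)`, `m = ⌊L/s⌋`
(`m³ ≥ 16(N+1)`); `χ_c(X) = ∏ᵢ (1 − θ_c(xᵢ))` (`θ_c` a smooth indicator of the `R₀`-neighbourhood of the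
cell `c`, transition width `s/4 ≤ side/4`, so each `xᵢ` meets `≤ 8` cells and `∑_c χ_c² ≥ m³/2`
EVERYWHERE — pigeonhole, no probability); `φ_c` a fixed `C¹` bump in the inner cell, `∫φ_c² = 1`,
disjoint supports; `F(X, y) = ∑_c χ_c(X) φ_c(y) / (∑_c χ_c(X)²)^{1/2}` has `∫ F² dy ≡ 1`, so for a
near-minimiser `Φ` of `E₀(N, L)` the `C¹` Dirichlet (unsymmetrised) `Ψ = Φ ⊗ F` has no cross term
(`∑_c u_c ∇u_c = ½∇ ∑ u_c² = 0`), no `y`–`X` interaction (distance `> R₀`), and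
`𝓔[Ψ] ≤ energy Φ + sup_X ∫(|∇_X F|² + |∇_y F|²) dy ≤ energy Φ + C_I/s²` (gradient of a unit vector field:
`∑_c |∇(χ_c/S)|² ≤ ∑_c |∇χ_c|²/S²`); Stub A turns `Ψ` into the bound on the BOSONIC `E₀(N+1, L)`.
[cite: LSSY2005, Thm 2.2 (cell method for upper bounds)] -/
theorem stub_cellInsertion :
    ∃ C_I : ℝ, 0 < C_I ∧ ∀ (N : ℕ) (v : ℝ → ℝ≥0∞) (L R₀ s : ℝ), Measurable v → 0 ≤ R₀ →
      (∀ r : ℝ, R₀ < r → v r = 0) → 0 < s → 4 * R₀ ≤ s →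
      128 * ((N : ℝ) + 1) * s ^ 3 ≤ L ^ 3 →
      groundStateEnergy v (N + 1) L ≤ groundStateEnergy v N L + ENNReal.ofReal (C_I / s ^ 2) := by
  sorry

/-- **Stub D — THE KERNEL (pure discrete geometry): at most one LOOSE component.** There are absolute
`K, c₀ > 0` such that for `N b³ ≤ c₀ L³` the free region
`F = {X ∈ Λ_L^N : |xᵢ − xⱼ| > b ∀ i ≠ j}` has an open, path-saturated, internally path-connected subset
`P₀ ⊆ F` (a path component, or `∅`) such that every point of `F ∖ P₀` lies in a component along which
ONE FIXED pair stays tightly bonded: `|yᵢ − yⱼ| < K b` for all `Y` joined to it. Strictly WEAKER than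
Stub 21 `stub_cubeConnected` of line `Sketch` (a connected `F` is its own `P₀`); true for every
container-jammed obstruction (first-order rigid strut frameworks keep their contacts — the vault foams of
KERNEL-c4 §2 included); false only for a "treadmill" component (no persistent bond, yet never dilute),
for which no mechanism is known. Small cases: `N ≤ 1` (`F` convex), boxes of diameter `< K b` (every pair
trivially bonded) — choose `K ≥ 9`, `c₀` small. [cite: BaryshnikovBubenikKahle2013, §6; Kahle2012] -/
theorem stub_uniqueLooseComponent :
    ∃ K c₀ : ℝ, 0 < K ∧ 0 < c₀ ∧ ∀ (N : ℕ) (L b : ℝ), 0 < b → (N : ℝ) * b ^ 3 ≤ c₀ * L ^ 3 →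
      ∃ P₀ : Set (Config N), IsOpen P₀ ∧
        P₀ ⊆ {Z : Config N | Z ∈ boxN N L ∧ ∀ i j : Fin N, i ≠ j → b < dist (Z i) (Z j)} ∧
        (∀ X ∈ P₀, ∀ Y ∈ P₀,
          JoinedIn {Z : Config N | Z ∈ boxN N L ∧ ∀ i j : Fin N, i ≠ j → b < dist (Z i) (Z j)} X Y) ∧
        (∀ X ∈ P₀, ∀ Y : Config N,
          JoinedIn {Z : Config N | Z ∈ boxN N L ∧ ∀ i j : Fin N, i ≠ j → b < dist (Z i) (Z j)} X Y →
            Y ∈ P₀) ∧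
        (∀ X ∈ {Z : Config N | Z ∈ boxN N L ∧ ∀ i j : Fin N, i ≠ j → b < dist (Z i) (Z j)}, X ∉ P₀ →
          ∃ i j : Fin N, i ≠ j ∧ ∀ Y : Config N,
            JoinedIn {Z : Config N | Z ∈ boxN N L ∧ ∀ i j : Fin N, i ≠ j → b < dist (Z i) (Z j)} X Y →
              dist (Y i) (Y j) < K * b) := by
  sorry

/-- **Stub E — THE GLUE (analysis): tight-bonded components carry no ground-state mass.** GIVEN Stubs A
and B as hypotheses: for `N ≥ 1`, `L > 0`, a measurable `v` with `v = ⊤` on `[0, b]` (`b > 0`), a bond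
constant `K > 0`, an insertion margin `E₀(N, L) ≤ E₀(N−1, L) + μ` with `μ < 1/(2K²b²)`, and an open
path-saturated `P₀ ⊆ F` off which every point of the free region `F` lies in a `K b`-bonded component,
every closed-form ground state vanishes a.e. off `P₀`. Proof: for a trial state `Φ` of finite energy,
`Φ = 0` on `{some pair ≤ b}` (hard core + continuity); with the core cutoff `χ_s` of the landed Stub 15a
(radii `b < b + 3s`), `χ_sΦ · 1_{P₀}` and the finitely many pieces `χ_sΦ · 1_{Q_{ij}}` (`Q_{ij}` = the
union of the components off `P₀` whose least bonded pair is `(i,j)`; open and closed in `F`) are `C¹`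
(`χ_s` vanishes to first order on the contact set; near `∂Λ` the free region is locally convex) with
additive energies and masses; Stub A on the `P₀`-piece, Stub B (after relabelling `i ↦ 0`, with
`a(Y) = (y_j)₀`, `R = K b`) and the margin on each bonded piece give
`𝓔[χ_sΦ] ≥ E₀ ‖χ_sΦ‖² + γ ‖χ_sΦ 1_{F∖P₀}‖²`, `γ = 1/(2K²b²) − μ > 0`; the landed Stubs 15b/15d make
`𝓔[χ_sΦ] → energy Φ` and `‖χ_sΦ‖ → 1` as `s → 0`, so `energy Φ ≥ E₀ + γ ∫_{F∖P₀} |Φ|²`; for a ground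
state `Ψ`, trial states `Φₙ → Ψ` in `L²` with energies `→ E₀` (`exists_trialState_near`) give
`∫_{F∖P₀}|Ψ|² = 0`, and `Ψ = 0` a.e. off `F` by the landed Stub 14 `stub_vanishOffFree`.
[cite: ReedSimonIV1978, §XIII.12 Thm XIII.47; LSSY2005, proof of Thm 2.4] -/
theorem stub_vanishOffLoose :
    (∀ (N : ℕ) (v : ℝ → ℝ≥0∞) (L : ℝ) (f : Config N → ℂ), Measurable v → ContDiff ℝ 1 f →
      (∀ X, X ∉ boxN N L → f X = 0) →
      groundStateEnergy v N L * ∫⁻ X, (‖f X‖₊ : ℝ≥0∞) ^ 2 ≤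
        ∫⁻ X, (kineticDensity f X + interaction v X * (‖f X‖₊ : ℝ≥0∞) ^ 2)) →
    (∀ (N : ℕ) (v : ℝ → ℝ≥0∞) (L R : ℝ) (f : Config (N + 1) → ℂ), Measurable v → 0 < R →
      ContDiff ℝ 1 f → (∀ X, X ∉ boxN (N + 1) L → f X = 0) →
      (∀ Y : Config N, ∃ a : ℝ, ∀ x : Space, R ≤ |x 0 - a| → f (Matrix.vecCons x Y) = 0) →
      (groundStateEnergy v N L + ENNReal.ofReal (1 / (2 * R ^ 2))) *
          ∫⁻ X, (‖f X‖₊ : ℝ≥0∞) ^ 2 ≤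
        ∫⁻ X, (kineticDensity f X + interaction v X * (‖f X‖₊ : ℝ≥0∞) ^ 2)) →
    ∀ (N : ℕ) (v : ℝ → ℝ≥0∞) (L b K : ℝ) (μ : ℝ≥0∞) (P₀ : Set (Config N)),
      1 ≤ N → 0 < L → 0 < b → 0 < K → Measurable v →
      (∀ s : ℝ, s ∈ Set.Icc 0 b → v s = ⊤) →
      groundStateEnergy v N L ≤ groundStateEnergy v (N - 1) L + μ →
      μ < ENNReal.ofReal (1 / (2 * (K * b) ^ 2)) →
      IsOpen P₀ →
      P₀ ⊆ {Z : Config N | Z ∈ boxN N L ∧ ∀ i j : Fin N, i ≠ j → b < dist (Z i) (Z j)} →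
      (∀ X ∈ P₀, ∀ Y : Config N,
        JoinedIn {Z : Config N | Z ∈ boxN N L ∧ ∀ i j : Fin N, i ≠ j → b < dist (Z i) (Z j)} X Y →
          Y ∈ P₀) →
      (∀ X ∈ {Z : Config N | Z ∈ boxN N L ∧ ∀ i j : Fin N, i ≠ j → b < dist (Z i) (Z j)}, X ∉ P₀ →
        ∃ i j : Fin N, i ≠ j ∧ ∀ Y : Config N,
          JoinedIn {Z : Config N | Z ∈ boxN N L ∧ ∀ i j : Fin N, i ≠ j → b < dist (Z i) (Z j)} X Y →
            dist (Y i) (Y j) < K * b) →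
      ∀ Ψ : Config N → ℂ, IsGroundState v L Ψ → ∀ᵐ X : Config N, X ∉ P₀ → Ψ X = 0 := by
  sorry

/-- **Stub F — OPEN KERNEL (the zoo), verbatim Stub 22 of line `Sketch` (shared): uniqueness at low
density for walls that are NOT a plain hard core with an essentially bounded tail** (hollow shells
`⊤·1_{[R₁,R₂]}`, hard cores with an essentially unbounded finite shoulder, fat-Cantor walls,
non-integrable finite walls). Not attempted by this line either; note that Stubs B/C/E price out the
gap-bonded sectors of hollow shells by the same mechanism (future reshape). [cite: ReedSimonIV1978, Thm XIII.48] -/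
theorem stub_uniquenessKernelZoo :
    ∀ v : ℝ → ℝ≥0∞, IsRepulsiveFiniteRange v →
      (¬ ∀ r : ℝ, 0 < r → ∃ C : ℝ≥0, ∀ᵐ s : ℝ, r ≤ s → v s ≤ C) →
      (¬ ∃ b : ℝ, 0 < b ∧ ∃ C : ℝ≥0, (∀ᵐ s : ℝ, s ∈ Set.Icc 0 b → v s = ⊤) ∧
          (∀ᵐ s : ℝ, b < s → v s ≤ C)) →
      ∃ ρ₀ : ℝ, 0 < ρ₀ ∧ ∀ ρ : ℝ, 0 < ρ → ρ < ρ₀ → ∀ᶠ N : ℕ in atTop,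
        ∀ Ψ Φ : Config N → ℂ, IsGroundState v (sideLength ρ N) Ψ →
          IsGroundState v (sideLength ρ N) Φ →
          ∃ c : ℂ, ‖c‖ = 1 ∧ ∀ᵐ X : Config N, Φ X = c * Ψ X := by
  sorry

/-! ## Assembly (sorry-free glue over Stubs A–F and the landed stubs of line `Sketch`) -/

/-- **Uniqueness for the ESSENTIAL hard-core class at low density, eventually, by loose-component
pricing** (Stubs A–E with the landed Stubs 0, 5a, 5b, 6, 14–20 of `Sketch`): if `v = ⊤` a.e. on `[0,b]`
and `v ≤ C` a.e. beyond `b` (`b > 0`), then for `ρ < ρ₀(v)` and all large `N` the ground state in the box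
of side `(N/ρ)^{1/3}` is unique up to phase. [cite: ReedSimonIV1978, §XIII.12 Thms XIII.44–XIII.47] -/
theorem uniqueHardCoreLoose (v : ℝ → ℝ≥0∞) (hv : IsRepulsiveFiniteRange v)
    (hHC : ∃ b : ℝ, 0 < b ∧ ∃ C : ℝ≥0, (∀ᵐ s : ℝ, s ∈ Set.Icc 0 b → v s = ⊤) ∧
      (∀ᵐ s : ℝ, b < s → v s ≤ C)) :
    ∃ ρ₀ : ℝ, 0 < ρ₀ ∧ ∀ ρ : ℝ, 0 < ρ → ρ < ρ₀ → ∀ᶠ N : ℕ in atTop,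
      HasUniqueGroundState v N (sideLength ρ N) := by
  obtain ⟨b, hb, C, hcoreae, htailae⟩ := hHC
  obtain ⟨R₀, hR₀⟩ := hv.2
  obtain ⟨K, c₀, hK, hc₀, hULC⟩ := stub_uniqueLooseComponent
  obtain ⟨CI, hCI, hINS⟩ := stub_cellInsertion
  obtain ⟨ρ₁, hρ₁, h₁⟩ := stub_finiteEnergyLowDensity v hv
  classical
  -- a pointwise representative off a null set of radii (as in `Sketch.uniqueHardCore`)
  set v' : ℝ → ℝ≥0∞ := fun s => if s ∈ Set.Icc 0 b then ⊤ else (if b < s then min (v s) C else v s)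
    with hv'def
  set Sbad : Set ℝ := {s | s ∈ Set.Icc 0 b ∧ v s ≠ ⊤} ∪ {s | b < s ∧ (C : ℝ≥0∞) < v s} with hSbad
  have hSm : MeasurableSet Sbad := by
    refine MeasurableSet.union ?_ ?_
    · exact measurableSet_Icc.inter (hv.1 (measurableSet_singleton ⊤)).compl
    · exact (measurableSet_lt measurable_const measurable_id).inter
        (measurableSet_lt measurable_const hv.1)
  have hS0 : volume Sbad = 0 := by
    rw [hSbad, measure_union_null_iff]
    constructor
    · rw [measure_eq_zero_iff_ae_notMem]
      filter_upwards [hcoreae] with s hs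
      simp only [not_and, not_not]
      exact hs
    · rw [measure_eq_zero_iff_ae_notMem]
      filter_upwards [htailae] with s hs
      simp only [not_and, not_lt]
      exact hs
  have hvv' : ∀ r, r ∉ Sbad → v r = v' r := by
    intro r hr
    simp only [hSbad, Set.mem_union, Set.mem_setOf_eq, not_or, not_and, not_not, not_lt] at hr
    by_cases h1 : r ∈ Set.Icc 0 b
    · simp only [hv'def]; rw [if_pos h1]; exact hr.1 h1
    · by_cases h2 : b < r
      · simp only [hv'def]; rw [if_neg h1, if_pos h2]; exact (min_eq_left (hr.2 h2)).symm
      · simp only [hv'def]; rw [if_neg h1, if_neg h2]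
  have hv'm : Measurable v' := by
    refine Measurable.ite measurableSet_Icc measurable_const ?_
    exact Measurable.ite (measurableSet_lt measurable_const measurable_id)
      (hv.1.min measurable_const) hv.1
  have hcore' : ∀ s : ℝ, s ∈ Set.Icc 0 b → v' s = ⊤ := fun s hs => by
    simp only [hv'def]; rw [if_pos hs]
  have htail' : ∀ s : ℝ, b < s → v' s ≤ C := by
    intro s hs
    have hs' : s ∉ Set.Icc 0 b := fun h => not_lt.2 h.2 hs
    simp only [hv'def]; rw [if_neg hs', if_pos hs]; exact min_le_right _ _
  -- the representative has finite range `R₁ = max R₀ b`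
  set R₁ : ℝ := max R₀ b with hR₁def
  have hR₁ : 0 ≤ R₁ := hb.le.trans (le_max_right _ _)
  have hrange' : ∀ r : ℝ, R₁ < r → v' r = 0 := by
    intro r hr
    have hbr : b < r := (le_max_right R₀ b).trans_lt hr
    have hR₀r : R₀ < r := (le_max_left R₀ b).trans_lt hr
    have hr' : r ∉ Set.Icc 0 b := fun h => not_lt.2 h.2 hbr
    simp only [hv'def]; rw [if_neg hr', if_pos hbr, hR₀ r hR₀r]; simp
  -- scales: cell size `s₀ ≥ 4 R₁` with `C_I / s₀² < 1 / (2 (K b)²)`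
  set s₀ : ℝ := max (4 * R₁) (2 * K * b * Real.sqrt CI) with hs₀def
  have h4R : 4 * R₁ ≤ s₀ := le_max_left _ _
  have hKb : 0 < K * b := mul_pos hK hb
  have hsq : 0 < Real.sqrt CI := Real.sqrt_pos.2 hCI
  have h2Kb : 0 < 2 * K * b * Real.sqrt CI := by positivity
  have hs₀pos : 0 < s₀ := h2Kb.trans_le (le_max_right _ _)
  have hμlt : ENNReal.ofReal (CI / s₀ ^ 2) < ENNReal.ofReal (1 / (2 * (K * b) ^ 2)) := by
    rw [ENNReal.ofReal_lt_ofReal_iff (by positivity)]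
    rw [div_lt_div_iff₀ (by positivity) (by positivity)]
    have h2 : 2 * K * b * Real.sqrt CI ≤ s₀ := le_max_right _ _
    have h3 : (2 * K * b * Real.sqrt CI) ^ 2 ≤ s₀ ^ 2 := by gcongr
    have h4 : (2 * K * b * Real.sqrt CI) ^ 2 = 4 * (K * b) ^ 2 * CI := by
      rw [mul_pow, Real.sq_sqrt hCI.le]; ring
    have h5 : 0 < (K * b) ^ 2 * CI := by positivity
    nlinarith [h3, h4, h5]
  refine ⟨min ρ₁ (min (c₀ / b ^ 3) (1 / (128 * s₀ ^ 3))),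
    lt_min hρ₁ (lt_min (by positivity) (by positivity)), fun ρ hρ hρm => ?_⟩
  have hρ₁' : ρ < ρ₁ := hρm.trans_le (min_le_left _ _)
  have hρc : ρ < c₀ / b ^ 3 := hρm.trans_le ((min_le_right _ _).trans (min_le_left _ _))
  have hρs : ρ < 1 / (128 * s₀ ^ 3) := hρm.trans_le ((min_le_right _ _).trans (min_le_right _ _))
  filter_upwards [h₁ ρ hρ hρ₁', eventually_ge_atTop 1] with N hE hN
  have hL : 0 < sideLength ρ N := sideLength_pos_of_pos hρ hN
  have hL3 : sideLength ρ N ^ 3 = N / ρ := Negative.sideLength_pow_three hρ (by omega)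
  have hE' : groundStateEnergy v' N (sideLength ρ N) ≠ ⊤ := by
    rwa [← groundStateEnergy_congr_offNull hSm hS0 hvv' N (sideLength ρ N)]
  have hNn : (0 : ℝ) ≤ N := by positivity
  -- density: `N b³ ≤ c₀ L³`
  have hdens : (N : ℝ) * b ^ 3 ≤ c₀ * sideLength ρ N ^ 3 := by
    rw [hL3]
    have hb3 : 0 < b ^ 3 := by positivity
    have h1 : ρ * b ^ 3 ≤ c₀ := by
      rw [lt_div_iff₀ hb3] at hρc
      exact hρc.le
    calc (N : ℝ) * b ^ 3 = (N / ρ) * (ρ * b ^ 3) := by field_simp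
      _ ≤ (N / ρ) * c₀ := by gcongr
      _ = c₀ * (N / ρ) := by ring
  obtain ⟨P₀, hP₀open, hP₀sub, hP₀join, hP₀sat, hP₀bond⟩ := hULC N (sideLength ρ N) b hb hdens
  -- insertion at `N - 1`: room for `128 N` cells of side `s₀`
  have hroom : 128 * (((N - 1 : ℕ) : ℝ) + 1) * s₀ ^ 3 ≤ sideLength ρ N ^ 3 := by
    have hcast : ((N - 1 : ℕ) : ℝ) + 1 = N := by
      rw [Nat.cast_sub hN]; push_cast; ring
    rw [hcast, hL3, le_div_iff₀ hρ]
    have h1 : ρ * (128 * s₀ ^ 3) ≤ 1 := by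
      rw [lt_div_iff₀ (by positivity)] at hρs
      exact hρs.le
    calc 128 * (N : ℝ) * s₀ ^ 3 * ρ = (N : ℝ) * (ρ * (128 * s₀ ^ 3)) := by ring
      _ ≤ (N : ℝ) * 1 := by gcongr
      _ = (N : ℝ) := mul_one _
  have hins := hINS (N - 1) v' (sideLength ρ N) R₁ s₀ hv'm hR₁ hrange' hs₀pos h4R hroom
  rw [Nat.sub_add_cancel hN] at hins
  -- ground states vanish off the loose part `P₀` (Stub E fed with Stubs A, B)
  have hvan := stub_vanishOffLoose stub_absoluteFloor stub_confinementFloor N v' (sideLength ρ N) b K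
    (ENNReal.ofReal (CI / s₀ ^ 2)) P₀ hN hL hb hK hv'm hcore' hins hμlt hP₀open hP₀sub hP₀sat hP₀bond
  have hP₀m : MeasurableSet P₀ := hP₀open.measurableSet
  -- component-wise Perron–Frobenius on the carrier `P₀` (landed Stubs 5b, 6, 16–20 of `Sketch`)
  have hU' : HasUniqueGroundState v' N (sideLength ρ N) := by
    refine stub_uniqueOfPosOn stub_lincombGroundState N v' (sideLength ρ N) P₀ hP₀m
      (stub_existsNonnegGroundState stub_compactness N v' (sideLength ρ N) hE') hvan ?_
    intro Ψ₀ hΨ₀ hGS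
    refine stub_posOfConnected (stub_chainedTube stub_localTubeCore) N v' (sideLength ρ N) b C hN hL hb
      hv'm hcore' htail'
      (groundStateEnergy_trunc_iSup_hardCore N v' (sideLength ρ N) b C hN hL hb hv'm hcore' htail')
      P₀ hP₀m hP₀sub ?_ hvan Ψ₀ hΨ₀ hGS
    intro X hX Y hY
    exact stub_polygonalChain N (sideLength ρ N) b X Y (hP₀join X hX Y hY)
  exact (hasUniqueGroundState_iff_offNull hSm hS0 hvv').2 hU'

/-- **Eventual uniqueness for every admissible `v`**: class (a) (`v` essentially locally bounded on
`(0, ∞)`, including essentially bounded `v`) by the landed `hasUniqueGroundState_of_essLocBdd` and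
Stub 5a; the essential hard-core class by `uniqueHardCoreLoose`; the zoo by Stub F. [folklore] -/
theorem eventualUniqueness (v : ℝ → ℝ≥0∞) (hv : IsRepulsiveFiniteRange v) :
    ∃ ρ₀ : ℝ, 0 < ρ₀ ∧ ∀ ρ : ℝ, 0 < ρ → ρ < ρ₀ → ∀ᶠ N : ℕ in atTop,
      HasUniqueGroundState v N (sideLength ρ N) := by
  by_cases hlb : ∀ r : ℝ, 0 < r → ∃ C : ℝ≥0, ∀ᵐ s : ℝ, r ≤ s → v s ≤ C
  · obtain ⟨ρ₁, hρ₁, h₁⟩ := stub_finiteEnergyLowDensity v hv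
    refine ⟨ρ₁, hρ₁, fun ρ hρ hρ₁' => ?_⟩
    filter_upwards [h₁ ρ hρ hρ₁', eventually_ge_atTop 1] with N hE hN
    exact hasUniqueGroundState_of_essLocBdd N v (sideLength ρ N) hN (sideLength_pos_of_pos hρ hN)
      hv.1 hlb hE
  · by_cases hHC : ∃ b : ℝ, 0 < b ∧ ∃ C : ℝ≥0, (∀ᵐ s : ℝ, s ∈ Set.Icc 0 b → v s = ⊤) ∧
        (∀ᵐ s : ℝ, b < s → v s ≤ C)
    · exact uniqueHardCoreLoose v hv hHC
    · obtain ⟨ρ₁, hρ₁, h₁⟩ := stub_finiteEnergyLowDensity v hv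
      obtain ⟨ρ₂, hρ₂, h₂⟩ := stub_uniquenessKernelZoo v hv hlb hHC
      refine ⟨min ρ₁ ρ₂, lt_min hρ₁ hρ₂, fun ρ hρ hρm => ?_⟩
      filter_upwards [h₁ ρ hρ (hρm.trans_le (min_le_left _ _)),
        h₂ ρ hρ (hρm.trans_le (min_le_right _ _))] with N hE hU
      exact ⟨stub_existsNonnegGroundState stub_compactness N v (sideLength ρ N) hE, hU⟩

/-! ## Composition (sorry-free): the stubs give the crux BY NAME -/

/-- **`GroundStateRigidity` from the six registered stubs** (kernel-checked glue, no `sorry` of its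
own): eventual uniqueness (above) and rigidity-from-uniqueness (landed Stub 1 fed with Stub 0).
[cite: ReedSimonIV1978, §XIII.12] -/
theorem GroundStateRigidity_of : GroundStateRigidity := by
  intro v hv
  obtain ⟨ρ₀, hρ₀, hU⟩ := eventualUniqueness v hv
  refine ⟨ρ₀, hρ₀, fun ρ hρ hρ₀' => ?_⟩
  filter_upwards [hU ρ hρ hρ₀'] with N hN
  intro η hη
  exact stub_rigidityOfUnique stub_compactness v N (sideLength ρ N) hN η hη

/-- The same composition read against the verbatim-shared decl of route `BECClassicalWindow` (the
item's first `wanted_by`; syntactically identical `def`). [cite: ReedSimonIV1978, §XIII.12] -/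
theorem GroundStateRigidity_proof :
    Summit.AtomisticToContinuum.BoseEinsteinCondensation.Theses.BECClassicalWindow.GroundStateRigidity :=
  GroundStateRigidity_of

/-- The same composition read against the verbatim-shared decl of route `BECHeatBathGap` (the BET route
of this strategist seat). [cite: ReedSimonIV1978, §XIII.12] -/
theorem GroundStateRigidity_proofHeatBathGap :
    Summit.AtomisticToContinuum.BoseEinsteinCondensation.Theses.BECHeatBathGap.GroundStateRigidity :=
  GroundStateRigidity_of

end Summit.AtomisticToContinuum.BoseEinsteinCondensation.Cruxes.GroundStateRigidity.LoosePricing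

end
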